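import Summits.CriticalPhenomena.PercolationContinuityZ3.Theorems.PercNearOneGluingNoHeavyLowerTailFKExactEval
import HarnessLib

/-!
# The hub-chain gadget `G₄(1/150, 1/150)`: exact isolation probabilities (kernel arithmetic)

Support file for crux `stmt-CriticalPhenomena-4575` (`NoHeavyLowerTail`, closed), seat `prim-nh-lead-4575` gen 114
(`--supports stmt-CriticalPhenomena-4575`); first of the files refuting the three-point variance row

  `(3PT)   P(a↔b)·P(a↮b) ≤ P(a↔b, a↮c) + P(a↔c, a↮b) + P(b↔c, a↮b)`   (conjectured for every finite weighted graph;
  kernel theorems: `ThreePointVariance.threePointVariance_le_five` (n ≤ 5), `ThreePointHubGraphs.threePointVariance_hubGraph`, …)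

following prim-l12-p6 gen 22's counterexample (memo `run/shared/lean/prim/prim-l12/FROM-prim-l12-p6-g22-3PT-REFUTED.md`): parallel powers,
glued at the three terminals, of a HUB CHAIN.  This file lists the gadget `G₄(1/150,1/150)` — vertices `Fin 7` (`0 = a`, `1 = b`, `2 = c`,
`3, 4, 5, 6 = h₁, h₂, h₃, h₄`), pairs `c–hᵢ` of weight `149/150` and the chain `a–h₁–h₂–h₃–h₄–b` of weight `1/150`, all other pairs weight `0` —
as `FK.RCEval` data at cluster weight `q = 1` (`rcMeasureW w 1 ∅ = prodBernoulli w`) and evaluates, by `decide +kernel` over the `2⁹`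
configurations of the listed pairs, the product-weight masses of the four isolation predicates read through `FK.RCEval.reachB`:
`Q₀ = P(a|b|c)`, `A₀ = P(c ↮ a, c ↮ b)`, `B₀ = P(b ↮ a, b ↮ c)`, `C₀ = P(a ↮ b, a ↮ c)` (exact rationals; two independent exact engines of the
lead, brute force and a chain transfer recursion, give the same values, `HOME/lab-gen114/cex3pt/`).  No named facts, no sorries, standard axioms.
-/

namespace Summit.CriticalPhenomena.PercolationContinuityZ3.Theorems.ThreePointVarianceRefutation

open MeasureTheory Literature.Probability.LatticeModels Literature.Probability.Percolation

/-- **The gadget `G₄(1/150,1/150)` as listed data**: seven vertices, pairs `23, 24, 25, 26` (hub–`c`, weight `149/150`) and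
`03, 34, 45, 56, 61` (the chain `a–h₁–h₂–h₃–h₄–b`, weight `1/150`), cluster weight `1`. (this seat, gen 114) -/
abbrev gad : FK.RCEval := ⟨7, 9, ![2, 2, 2, 2, 0, 3, 4, 5, 6], ![3, 4, 5, 6, 3, 4, 5, 6, 1],
  ![149 / 150, 149 / 150, 149 / 150, 149 / 150, 1 / 150, 1 / 150, 1 / 150, 1 / 150, 1 / 150], 1⟩

/-- The listing is valid (pairs distinct, weights in `[0,1]`, `q > 0`). [folklore] -/
theorem gad_valid : gad.Valid := by decide +kernel

/-- `Σ_t [P t] · ∏_i (c_i or 1 − c_i)` — the mass of a predicate under the product weights (computable). [folklore] -/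
def massW (P : Finset (Fin 9) → Bool) : ℚ := ∑ t : Finset (Fin 9), if P t then gad.wQ t else 0

/-- At `q = 1`, `massQ = massW`. [folklore] -/
theorem massQ_eq_massW (P : Finset (Fin 9) → Bool) : gad.massQ P = massW P := by
  unfold FK.RCEval.massQ massW FK.RCEval.mQ
  refine Finset.sum_congr rfl fun t _ => ?_
  have hq : gad.q = 1 := rfl
  rw [hq, one_pow, mul_one]

/-- At `q = 1`, `ZQ = Σ_t wQ t`. [folklore] -/
theorem zq_eq : gad.ZQ = massW (fun _ => true) := by
  unfold FK.RCEval.ZQ massW FK.RCEval.mQ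
  refine Finset.sum_congr rfl fun t _ => ?_
  have hq : gad.q = 1 := rfl
  rw [hq, one_pow, mul_one, if_pos rfl]

/-- `a | b | c` (pairwise not joined by open listed pairs). (this seat, gen 114) -/
def pQ (t : Finset (Fin 9)) : Bool := !(gad.reachB t 0 1) && !(gad.reachB t 0 2) && !(gad.reachB t 1 2)
/-- `c` isolated from `a` and `b`. -/
def pA (t : Finset (Fin 9)) : Bool := !(gad.reachB t 2 0) && !(gad.reachB t 2 1)
/-- `b` isolated from `a` and `c`. -/
def pB (t : Finset (Fin 9)) : Bool := !(gad.reachB t 1 0) && !(gad.reachB t 1 2)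
/-- `a` isolated from `b` and `c`. -/
def pC (t : Finset (Fin 9)) : Bool := !(gad.reachB t 0 1) && !(gad.reachB t 0 2)

/-! ### Kernel arithmetic (`decide +kernel`, `2⁹` configurations each) -/

set_option maxHeartbeats 0 in
/-- `Z = 1`. [folklore] -/
theorem massW_true : massW (fun _ => true) = 1 := by decide +kernel
set_option maxHeartbeats 0 in
/-- `Q₀ = P(a|b|c) = 7587172369084689269/7688671875000000000`. (this seat, gen 114; two exact engines agree) -/
theorem mass_Q : massW pQ = 7587172369084689269 / 7688671875000000000 := by decide +kernel
set_option maxHeartbeats 0 in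
/-- `A₀ = P(c isolated) = 18967930922711723173/19221679687500000000`. -/
theorem mass_A : massW pA = 18967930922711723173 / 19221679687500000000 := by decide +kernel
set_option maxHeartbeats 0 in
/-- `B₀ = P(b isolated) = 38188767591059602649/38443359375000000000`. -/
theorem mass_B : massW pB = 38188767591059602649 / 38443359375000000000 := by decide +kernel
set_option maxHeartbeats 0 in
/-- `C₀ = P(a isolated) = B₀`. -/
theorem mass_C : massW pC = 38188767591059602649 / 38443359375000000000 := by decide +kernel

/-- At `q = 1` the random-cluster measure of the listing is the Bernoulli product measure. [cite: Grimmett2006, §1.3] -/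
theorem rc_eq : rcMeasureW gad.w ((gad.q : ℚ) : ℝ) ∅ = prodBernoulli gad.w := by
  have : ((gad.q : ℚ) : ℝ) = 1 := by norm_num [gad]
  rw [this]; exact rcMeasureW_one gad.w ∅

/-- **Exact probability of a predicate-described event under the gadget's product measure**: `P(X) = massW P` whenever
`conf t ∈ X ↔ P t`. [folklore] -/
theorem real_eq_massW {X : Set (BondConfig (Fin 7))} {P : Finset (Fin 9) → Bool} (h : ∀ t, gad.conf t ∈ X ↔ P t = true) :
    (prodBernoulli gad.w).real X = ((massW P : ℚ) : ℝ) := by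
  have h := FK.RCEval.real_eq_massQ_div gad_valid h
  rw [rc_eq, massQ_eq_massW, zq_eq, massW_true, div_one] at h
  exact h

end Summit.CriticalPhenomena.PercolationContinuityZ3.Theorems.ThreePointVarianceRefutation
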